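import Literature.AlgebraicGeometry.GroupSchemes.FrobeniusKillsQuotientEtale        -- ★ `FrobKillEt.finrank_alg_specOver_quotient`; (transitively) ★ `quotIncl`, `mono_quotIncl`
import Literature.AlgebraicGeometry.GroupSchemes.BTGroupUniformizerKernelRank        -- ★ `Alg.finrank_eq_of_iso`, `exists_iso_of_fac_of_fac`
import Literature.AlgebraicGeometry.AbelianSchemes.AbelianSchemeOverRingAction       -- ★ `AbelianSchemeOver.RingAction`
import HarnessLib

/-!
# Reading a kernel on a dock: subschemes with the points of `V(I) ↪ G₀ ↪ X`, their rank, and the agreement of two readings on a layer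

Topic `Literature/AlgebraicGeometry/AbelianSchemes`; namespace `Literature.AlgebraicGeometry.AbelianSchemes.DockKernelReading`.
THEOREMS ONLY (no definition, no instance, no notation, no named fact, no `sorry`).  Cell `hodgecm-mathlib` (D-0151), programme P6 «MOD»
(crux hLiu418 = stmt-HodgeConjecture-24832, `--supports`, count-neutral), half A line L3 (socket `stub_ROOF0`), organ (R3) «the `c•w` kernel
reading of the reduced leg `q̄`» — the RANK and AGREEMENT rows that the `w`-block count `hcount` (LA3-p03 (g3), W-DOCK `WBlockLawLA3.hrk_of_layer_count`)
and the (E) socket of ★ W-DOCK `WBlockLaw.rL_W` consume, stated over a DOCK given by hypotheses in the field shapes of the D-line record `DockData`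
(`G₀`, `ι₀G`, `hkerG₀`, `hrkF₀`) so that the Lines glue is one `exact` per row.  HC_CM is proved only modulo the printed citations until rung 0
closes; this file is generic and changes no count.

THE PRINT.  [GortzWedhorn2023] (27.1.1) and §(27.2) (p. 607), [Waterhouse1979] §2.1: for an affine group scheme `G₀ = Spec A₀` over a field `k`,
closed subschemes `V(I) = Spec (A₀ ⧸ I) ↪ G₀` correspond to ideals `I ⊆ A₀`, and `Γ(V(I)) = A₀ ⧸ I` (★ `AffineGroupScheme.quotIncl`, ★
`FrobKillEt.finrank_alg_specOver_quotient`).  [GortzWedhorn2020] Definition 4.45 (2) (p. 117) and Section (4.7): a subscheme is determined, as a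
subobject, by its functor of points — two monomorphisms `Z ↪ X`, `Z′ ↪ X` with the same `T`-points for all `T` are isomorphic over `X` (★
`exists_iso_of_fac_of_fac`), hence have isomorphic affine algebras (★ `Alg.finrank_eq_of_iso`).  [Tate1997FiniteFlatGroupSchemes] (3.7): the order
of a finite `k`-group scheme is `dim_k` of its affine algebra; for the DOCK of the application — the `𝔭`-torsion `G₀ = A[𝔭] ↪ A` of an abelian
scheme with `𝒪`-action (`hkerG₀`: «`t ∈ A[𝔭] ↔ ι(r) t = 1 ∀ r ∈ 𝔭`») and its Frobenius-kernel ideal `I = ker Γ(ι_{Ker F})` of colength `q`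
(`hrkF₀`) — every closed subscheme `Z ↪ A` whose `T`-points are «`𝔭`-torsion AND killed by `q̄`» has order `q` as soon as the DOCK CLAUSE
«on `G₀`, killed by `q̄` ↔ lies in `V(I)`» holds ([Liu2021] Prop. D.8 (3), pp. 136–138: the kernel of the reduced Hecke leg meets the `c•w`-block
in the Frobenius kernel).  The same bookkeeping shows that two predicates on points with the SAME dock clause (e.g. «killed by `q̄`» and «killed by
`F_q`») agree on every layer `L ↪ A` each of whose relevant points lands on the dock — the (E) identification `Ker q̄ ∩ 𝒢l = Ker F ∩ 𝒢l`.

* §1 (any `X`, dock `ι₀ : G₀ ↪ X`, ideal `I`) `exists_iso_of_points_iff_comp_quotIncl` (`Z ≅ V(I)` over `X`),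
  **`finrank_alg_eq_of_points_iff_comp_quotIncl`** (`dim Γ(Z) = dim Γ(G₀) ⧸ I`).
* §2 (a predicate `P` on `X`-points with a dock clause `hdock`) `points_iff_comp_quotIncl_of_dockClause`, **`finrank_alg_eq_of_dockClause`**
  (points «on the dock ∧ `P`» ⇒ rank `dim Γ(G₀) ⧸ I`).
* §3 (a layer `jl : L ↪ X` containing the dock) `iff_of_dockClauses` (two predicates with the same dock clause agree on points landing on the dock),
  **`points_iff_points_of_dockClauses`** (the (E) shape «`(∃ c, c ≫ φ = y) ↔ ∃ c, c ≫ κ = y`» for subobjects `κ`, `φ` of `L` reading `P`, `Q`),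
  **`finrank_alg_eq_of_dockClause_layer`** (such a `κ` has rank `dim Γ(G₀) ⧸ I`).
* §4 (A-currency: `A : AbelianSchemeOver (Spec k)`, action `act`, ideal `𝔴`, dock rows `hkerG₀`) **`finrank_alg_eq_of_idealTorsion_dockClause`**,
  **`finrank_alg_eq_of_idealTorsion_comp_eq_one`** («`𝔴`-torsion ∧ `q̄`-killed» ⇒ rank `dim Γ(G₀) ⧸ I`),
  **`finrank_alg_eq_of_layer_comp_eq_one`** («in `L` ∧ `q̄`-killed», given `Ker q̄ ∩ L ⊆ A[𝔴]`), **`points_iff_points_of_layer`** (the (E) shape on `L`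
  from the two dock clauses and the two «lands in `A[𝔴]`» rows); (ED. 2) **`points_iff_points_of_layer_comp_eq_one`** (both readings as compositions
  `x ≫ q̄ = 1`, `x ≫ F' = 1`, right-associated dock clauses — the Lines letters' binder shape).

## References
* [GortzWedhorn2023] U. Görtz, T. Wedhorn, *Algebraic Geometry II* (2023), (27.1.1), §(27.2) (p. 607).
* [GortzWedhorn2020] U. Görtz, T. Wedhorn, *Algebraic Geometry I* (2nd ed. 2020), Definition 4.45 (2) (p. 117), Section (4.7).
* [Waterhouse1979] W. C. Waterhouse, *Introduction to Affine Group Schemes*, GTM 66 (1979), §2.1.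
* [Tate1997FiniteFlatGroupSchemes] J. Tate, *Finite flat group schemes*, in: Modular Forms and Fermat's Last Theorem (1997), (3.7).
* [Liu2021] Y. Liu, *Fourier–Jacobi cycles and arithmetic relative trace formula*, Camb. J. Math. 9 (2021), Appendix D, Prop. D.8 (3) (pp. 136–138).
-/

set_option autoImplicit false

-- Mathlib's `Over`/`Scheme` APIs are stated across semireducible wrappers (as in ★ `GroupSchemes/*`).
set_option backward.isDefEq.respectTransparency false

noncomputable section

open CategoryTheory CategoryTheory.Limits AlgebraicGeometry MonoidalCategory CartesianMonoidalCategory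

open scoped MonObj

universe u

namespace Literature.AlgebraicGeometry.AbelianSchemes.DockKernelReading

open Literature.AlgebraicGeometry.Motives Literature.AlgebraicGeometry.GroupSchemes
open Literature.AlgebraicGeometry.GroupSchemes.AffineGroupScheme

/-! ## §1 A subscheme with the points of `V(I) ↪ G₀ ↪ X` is `V(I)`; its rank -/

section Subobject

variable {k : Type u} [Field k] {X : SchemeOver k} (G₀ : SchemeOver k) [IsAffine G₀.left] (ι₀ : G₀ ⟶ X) [Mono ι₀]
  (I : Ideal (Alg G₀))

/-- **`Z ≅ V(I)` OVER `X`.**  For a DOCK `ι₀ : G₀ ↪ X` (`G₀` affine, `ι₀` a monomorphism), an ideal `I ⊆ Γ(G₀)` and a monomorphism `ζ : Z ↪ X` whose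
`T`-points are, for every `T`, exactly the `T`-points of `X` factoring through `V(I) = Spec (Γ(G₀) ⧸ I) ↪ G₀ ↪ X` (★ `quotIncl`), there is an
isomorphism `Z ≅ V(I)` compatible with the two embeddings into `X` (two subobjects with mutual factorisations, ★ `exists_iso_of_fac_of_fac`).
[cite: GortzWedhorn2020, Definition 4.45 (2) (p. 117)] [cite: GortzWedhorn2023, (27.1.1) and §(27.2) (p. 607)] -/
theorem exists_iso_of_points_iff_comp_quotIncl {Z : SchemeOver k} (ζ : Z ⟶ X) [Mono ζ]
    (hZ : ∀ ⦃T : SchemeOver k⦄ (x : T ⟶ X),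
      (∃ z : T ⟶ Z, z ≫ ζ = x) ↔ ∃ s : T ⟶ Motives.specOver k (Alg G₀ ⧸ I), (s ≫ quotIncl G₀ I) ≫ ι₀ = x) :
    ∃ e : Z ≅ Motives.specOver k (Alg G₀ ⧸ I), e.hom ≫ (quotIncl G₀ I ≫ ι₀) = ζ ∧ e.inv ≫ ζ = quotIncl G₀ I ≫ ι₀ := by
  haveI := mono_quotIncl G₀ I
  haveI : Mono (quotIncl G₀ I ≫ ι₀) := mono_comp _ _
  obtain ⟨u, hu⟩ := (hZ ζ).1 ⟨𝟙 Z, Category.id_comp ζ⟩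
  obtain ⟨v, hv⟩ := (hZ (quotIncl G₀ I ≫ ι₀)).2 ⟨𝟙 _, by rw [Category.id_comp]⟩
  exact exists_iso_of_fac_of_fac ζ (quotIncl G₀ I ≫ ι₀) u (by rw [← Category.assoc]; exact hu) v hv

/-- **`dim_k Γ(Z) = dim_k Γ(G₀) ⧸ I`** for a monomorphism `ζ : Z ↪ X` with the `T`-points of `V(I) ↪ G₀ ↪ X` (`Z ≅ V(I)` by
`exists_iso_of_points_iff_comp_quotIncl`, ★ `Alg.finrank_eq_of_iso`, and `Γ(V(I)) ≅ Γ(G₀) ⧸ I`, ★ `FrobKillEt.finrank_alg_specOver_quotient`).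
[cite: Tate1997FiniteFlatGroupSchemes, (3.7)] [cite: GortzWedhorn2023, (27.1.1) and §(27.2) (p. 607)] -/
theorem finrank_alg_eq_of_points_iff_comp_quotIncl {Z : SchemeOver k} (ζ : Z ⟶ X) [Mono ζ]
    (hZ : ∀ ⦃T : SchemeOver k⦄ (x : T ⟶ X),
      (∃ z : T ⟶ Z, z ≫ ζ = x) ↔ ∃ s : T ⟶ Motives.specOver k (Alg G₀ ⧸ I), (s ≫ quotIncl G₀ I) ≫ ι₀ = x) :
    Module.finrank k (Alg Z) = Module.finrank k (Alg G₀ ⧸ I) := by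
  obtain ⟨e, -, -⟩ := exists_iso_of_points_iff_comp_quotIncl G₀ ι₀ I ζ hZ
  rw [Alg.finrank_eq_of_iso e, FrobKillEt.finrank_alg_specOver_quotient]

end Subobject

/-! ## §2 The predicate form: a dock clause -/

section DockClause

variable {k : Type u} [Field k] {X : SchemeOver k} (G₀ : SchemeOver k) [IsAffine G₀.left] (ι₀ : G₀ ⟶ X) [Mono ι₀]
  (I : Ideal (Alg G₀)) (P : ∀ ⦃T : SchemeOver k⦄, (T ⟶ X) → Prop)
  (hdock : ∀ ⦃T : SchemeOver k⦄ (g : T ⟶ G₀), P (g ≫ ι₀) ↔ ∃ s : T ⟶ Motives.specOver k (Alg G₀ ⧸ I), s ≫ quotIncl G₀ I = g)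

include hdock in
omit [Mono ι₀] in
/-- **The DOCK CLAUSE read on `X`-points.**  If a predicate `P` on points of `X` satisfies, ON THE DOCK `G₀`, «`P (g ≫ ι₀) ↔ g` factors through
`V(I)`» (`hdock`), then a point of `X` lies on the dock and satisfies `P` iff it factors through `V(I) ↪ G₀ ↪ X`.
[cite: GortzWedhorn2020, Definition 4.45 (2) (p. 117)] -/
theorem points_iff_comp_quotIncl_of_dockClause ⦃T : SchemeOver k⦄ (x : T ⟶ X) :
    ((∃ g : T ⟶ G₀, g ≫ ι₀ = x) ∧ P x) ↔ ∃ s : T ⟶ Motives.specOver k (Alg G₀ ⧸ I), (s ≫ quotIncl G₀ I) ≫ ι₀ = x := by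
  constructor
  · rintro ⟨⟨g, rfl⟩, hP⟩
    obtain ⟨s, rfl⟩ := (hdock g).1 hP
    exact ⟨s, rfl⟩
  · rintro ⟨s, rfl⟩
    exact ⟨⟨s ≫ quotIncl G₀ I, rfl⟩, (hdock _).2 ⟨s, rfl⟩⟩

include hdock in
/-- **RANK FROM A DOCK CLAUSE**: a monomorphism `ζ : Z ↪ X` whose `T`-points are «on the dock `G₀` AND `P`» has `dim_k Γ(Z) = dim_k Γ(G₀) ⧸ I`
(§1 through `points_iff_comp_quotIncl_of_dockClause`).  In the application: `X = A_x̄`, `G₀ = A_x̄[𝔭_{c•w}]`, `I` the Frobenius-kernel ideal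
(`dim = q`), `P x := x ≫ q̄ = 1` — «the kernel of the reduced leg meets the `c•w`-dock in a subgroup of order `q`».
[cite: Tate1997FiniteFlatGroupSchemes, (3.7)] [cite: Liu2021, Prop. D.8 (3) pp. 136–138] -/
theorem finrank_alg_eq_of_dockClause {Z : SchemeOver k} (ζ : Z ⟶ X) [Mono ζ]
    (hZ : ∀ ⦃T : SchemeOver k⦄ (x : T ⟶ X), (∃ z : T ⟶ Z, z ≫ ζ = x) ↔ (∃ g : T ⟶ G₀, g ≫ ι₀ = x) ∧ P x) :
    Module.finrank k (Alg Z) = Module.finrank k (Alg G₀ ⧸ I) :=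
  finrank_alg_eq_of_points_iff_comp_quotIncl G₀ ι₀ I ζ fun _ x =>
    (hZ x).trans (points_iff_comp_quotIncl_of_dockClause G₀ ι₀ I P hdock x)

end DockClause

/-! ## §3 Two readings with the same dock clause agree on a layer containing the dock -/

section Layer

variable {k : Type u} [Field k] {X : SchemeOver k} (G₀ : SchemeOver k) [IsAffine G₀.left] (ι₀ : G₀ ⟶ X) [Mono ι₀]
  (I : Ideal (Alg G₀)) (P Q : ∀ ⦃T : SchemeOver k⦄, (T ⟶ X) → Prop)
  (hP : ∀ ⦃T : SchemeOver k⦄ (g : T ⟶ G₀), P (g ≫ ι₀) ↔ ∃ s : T ⟶ Motives.specOver k (Alg G₀ ⧸ I), s ≫ quotIncl G₀ I = g)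
  (hQ : ∀ ⦃T : SchemeOver k⦄ (g : T ⟶ G₀), Q (g ≫ ι₀) ↔ ∃ s : T ⟶ Motives.specOver k (Alg G₀ ⧸ I), s ≫ quotIncl G₀ I = g)

include hP hQ in
omit [Mono ι₀] in
/-- **Two predicates with the SAME dock clause agree at every point that each of them puts on the dock.**  (`P` = «killed by `q̄`», `Q` = «killed by
`F_q`», both reading `V(I)` on `G₀`; `hPx`∕`hQx` = the «lands on the dock» rows, in the application `Ker q̄ ⊆ A[𝔭_w𝔭_{c•w}]` resp. Frobenius saturation.)
[cite: Liu2021, Prop. D.8 (3) pp. 136–138] -/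
theorem iff_of_dockClauses ⦃T : SchemeOver k⦄ (x : T ⟶ X) (hPx : P x → ∃ g : T ⟶ G₀, g ≫ ι₀ = x)
    (hQx : Q x → ∃ g : T ⟶ G₀, g ≫ ι₀ = x) : P x ↔ Q x := by
  constructor
  · intro h
    obtain ⟨g, rfl⟩ := hPx h
    exact (hQ g).2 ((hP g).1 h)
  · intro h
    obtain ⟨g, rfl⟩ := hQx h
    exact (hP g).2 ((hQ g).1 h)

include hP hQ in
omit [Mono ι₀] in
/-- **The (E) shape on a layer.**  Let `jl : L → X` be a layer, `κ : K → L` and `φ : Φ → L` subobjects reading `P` resp. `Q` on `L`-points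
(«`(∃ c, c ≫ κ = y) ↔ P (y ≫ jl)`», «`(∃ c, c ≫ φ = y) ↔ Q (y ≫ jl)`»), where `P`, `Q` have the same dock clause and every `L`-point satisfying either
lands on the dock (`hPL`, `hQL`).  Then `κ` and `φ` have the same `T`-points: «`(∃ c, c ≫ φ = y) ↔ ∃ c, c ≫ κ = y`» — the binder `hE` of ★ W-DOCK
`WBlockLaw.heart_of_points` ∕ `law_w_of_points` («`Ker q̄ ∩ 𝒢l = Ker F ∩ 𝒢l`»). [cite: Liu2021, Prop. D.8 (3) pp. 136–138]
[cite: GortzWedhorn2020, Definition 4.45 (2) (p. 117)] -/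
theorem points_iff_points_of_dockClauses {L : SchemeOver k} (jl : L ⟶ X)
    (hPL : ∀ ⦃T : SchemeOver k⦄ (y : T ⟶ L), P (y ≫ jl) → ∃ g : T ⟶ G₀, g ≫ ι₀ = y ≫ jl)
    (hQL : ∀ ⦃T : SchemeOver k⦄ (y : T ⟶ L), Q (y ≫ jl) → ∃ g : T ⟶ G₀, g ≫ ι₀ = y ≫ jl)
    {K : SchemeOver k} (κ : K ⟶ L) (hκ : ∀ ⦃T : SchemeOver k⦄ (y : T ⟶ L), (∃ c : T ⟶ K, c ≫ κ = y) ↔ P (y ≫ jl))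
    {Φ : SchemeOver k} (φ : Φ ⟶ L) (hφ : ∀ ⦃T : SchemeOver k⦄ (y : T ⟶ L), (∃ c : T ⟶ Φ, c ≫ φ = y) ↔ Q (y ≫ jl))
    ⦃T : SchemeOver k⦄ (y : T ⟶ L) : (∃ c : T ⟶ Φ, c ≫ φ = y) ↔ ∃ c : T ⟶ K, c ≫ κ = y := by
  rw [hφ y, hκ y]
  exact (iff_of_dockClauses G₀ ι₀ I P Q hP hQ (y ≫ jl) (hPL y) (hQL y)).symm

include hP in
/-- **RANK OF A READING ON A LAYER.**  If the layer `jl : L ↪ X` (a monomorphism) CONTAINS the dock (`l₀ ≫ jl = ι₀`) and every `L`-point satisfying `P`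
lands on the dock (`hPL`), then a subobject `κ : K ↪ L` reading `P` («`(∃ c, c ≫ κ = y) ↔ P (y ≫ jl)`») has `dim_k Γ(K) = dim_k Γ(G₀) ⧸ I` — its points
in `X` are those of `V(I)` (§1).  In the application: `K = Ker q̄ ∩ 𝒢l` (or `Ker F ∩ 𝒢l`) has order `q`. [cite: Tate1997FiniteFlatGroupSchemes, (3.7)]
[cite: Liu2021, Prop. D.8 (3) pp. 136–138] -/
theorem finrank_alg_eq_of_dockClause_layer {L : SchemeOver k} (jl : L ⟶ X) [Mono jl] (l₀ : G₀ ⟶ L) (hl₀ : l₀ ≫ jl = ι₀)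
    (hPL : ∀ ⦃T : SchemeOver k⦄ (y : T ⟶ L), P (y ≫ jl) → ∃ g : T ⟶ G₀, g ≫ ι₀ = y ≫ jl)
    {K : SchemeOver k} (κ : K ⟶ L) [Mono κ] (hκ : ∀ ⦃T : SchemeOver k⦄ (y : T ⟶ L), (∃ c : T ⟶ K, c ≫ κ = y) ↔ P (y ≫ jl)) :
    Module.finrank k (Alg K) = Module.finrank k (Alg G₀ ⧸ I) := by
  haveI : Mono (κ ≫ jl) := mono_comp _ _
  refine finrank_alg_eq_of_points_iff_comp_quotIncl G₀ ι₀ I (κ ≫ jl) fun T x => ?_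
  constructor
  · rintro ⟨c, rfl⟩
    obtain ⟨g, hg⟩ := hPL (c ≫ κ) ((hκ (c ≫ κ)).1 ⟨c, rfl⟩)
    obtain ⟨s, rfl⟩ := (hP g).1 (by rw [hg]; exact (hκ (c ≫ κ)).1 ⟨c, rfl⟩)
    exact ⟨s, by simpa only [Category.assoc] using hg⟩
  · rintro ⟨s, rfl⟩
    have hPs : P (((s ≫ quotIncl G₀ I) ≫ l₀) ≫ jl) := by
      rw [Category.assoc, hl₀]
      exact (hP _).2 ⟨s, rfl⟩
    obtain ⟨c, hc⟩ := (hκ ((s ≫ quotIncl G₀ I) ≫ l₀)).2 hPs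
    exact ⟨c, by rw [← Category.assoc, hc, Category.assoc, hl₀]⟩

end Layer

/-! ## §4 A-currency: the dock `G₀ = A[𝔴] ↪ A` of an abelian scheme with `𝒪`-action -/

section Abelian

variable {k : Type u} [Field k] (A : AbelianSchemeOver (Spec (.of k))) {O : Type*} [CommRing O] (act : A.RingAction O) (𝔴 : Ideal O)
  -- the dock: `G₀ = A[𝔴]` by its all-`T`-points law (D-line `DockData.G₀ ∕ ι₀G ∕ hkerG₀`), and an ideal of `Γ(G₀)` (D-line: `kerFI`, colength `hrkF₀`)
  (G₀ : SchemeOver k) [IsAffine G₀.left] (ι₀G : G₀ ⟶ A.X) [Mono ι₀G]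
  (hkerG₀ : ∀ ⦃T : SchemeOver k⦄ (t : T ⟶ A.X), (∀ r ∈ 𝔴, t ≫ act.i r = 1) ↔ ∃ s : T ⟶ G₀, s ≫ ι₀G = t)
  (I : Ideal (Alg G₀))

include hkerG₀ in
/-- **RANK OF A `𝔴`-TORSION READING, predicate form**: with the dock clause `hdock` for `P` at the ideal `I`, every monomorphism `ζ : Z ↪ A` whose
`T`-points are «`𝔴`-torsion ∧ `P`» has `dim_k Γ(Z) = dim_k Γ(G₀) ⧸ I` (§2 with `hkerG₀`). [cite: Tate1997FiniteFlatGroupSchemes, (3.7)]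
[cite: Liu2021, Prop. D.8 (3) pp. 136–138] -/
theorem finrank_alg_eq_of_idealTorsion_dockClause (P : ∀ ⦃T : SchemeOver k⦄, (T ⟶ A.X) → Prop)
    (hdock : ∀ ⦃T : SchemeOver k⦄ (g : T ⟶ G₀), P (g ≫ ι₀G) ↔ ∃ s : T ⟶ Motives.specOver k (Alg G₀ ⧸ I), s ≫ quotIncl G₀ I = g)
    {Z : SchemeOver k} (ζ : Z ⟶ A.X) [Mono ζ]
    (hZ : ∀ ⦃T : SchemeOver k⦄ (x : T ⟶ A.X), (∃ z : T ⟶ Z, z ≫ ζ = x) ↔ (∀ r ∈ 𝔴, x ≫ act.i r = 1) ∧ P x) :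
    Module.finrank k (Alg Z) = Module.finrank k (Alg G₀ ⧸ I) :=
  finrank_alg_eq_of_dockClause G₀ ι₀G I P hdock ζ fun _ x => by rw [hZ x, hkerG₀ x]

include hkerG₀ in
/-- **RANK OF «`𝔴`-TORSION ∧ KILLED BY `q̄`»**: for `q̄ : A → Y` with the dock clause «on `G₀ = A[𝔴]`, killed by `q̄` ↔ lies in `V(I)`» (`hdock`, the
(R3) kernel reading), every monomorphism `ζ : Z ↪ A` with `T`-points «`ι(r) x = 1 ∀ r ∈ 𝔴` ∧ `x ≫ q̄ = 1`» has `dim_k Γ(Z) = dim_k Γ(G₀) ⧸ I` (`= q` at the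
Frobenius-kernel ideal) — the row «`rk Γ(Ker q̄ ∩ A[𝔭_{c•w}]) = q`» of the `w`-block count. [cite: Tate1997FiniteFlatGroupSchemes, (3.7)]
[cite: Liu2021, Prop. D.8 (3) pp. 136–138] -/
theorem finrank_alg_eq_of_idealTorsion_comp_eq_one {Y : SchemeOver k} [GrpObj Y] (qbar : A.X ⟶ Y)
    (hdock : ∀ ⦃T : SchemeOver k⦄ (g : T ⟶ G₀),
      g ≫ ι₀G ≫ qbar = 1 ↔ ∃ s : T ⟶ Motives.specOver k (Alg G₀ ⧸ I), s ≫ quotIncl G₀ I = g)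
    {Z : SchemeOver k} (ζ : Z ⟶ A.X) [Mono ζ]
    (hZ : ∀ ⦃T : SchemeOver k⦄ (x : T ⟶ A.X), (∃ z : T ⟶ Z, z ≫ ζ = x) ↔ (∀ r ∈ 𝔴, x ≫ act.i r = 1) ∧ x ≫ qbar = 1) :
    Module.finrank k (Alg Z) = Module.finrank k (Alg G₀ ⧸ I) := by
  refine finrank_alg_eq_of_idealTorsion_dockClause A act 𝔴 G₀ ι₀G hkerG₀ I (fun _ x => x ≫ qbar = 1) (fun _ g => ?_) ζ hZ
  rw [Category.assoc]
  exact hdock g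

include hkerG₀ in
/-- **RANK OF «IN THE LAYER `L` ∧ KILLED BY `q̄`»**: for a layer `jl : L ↪ A` containing the dock (`l₀ ≫ jl = ι₀G`; e.g. `L = 𝒢l ⊇ A[𝔭_{c•w}]`) on which
`Ker q̄` is `𝔴`-torsion (`hkerdown`: the downstairs kernel bound `Ker q̄ ⊆ A[𝔭_w𝔭_{c•w}]` read on the `c•w`-primary layer), every subobject
`κ : K ↪ L` reading «`(y ≫ jl) ≫ q̄ = 1`» has `dim_k Γ(K) = dim_k Γ(G₀) ⧸ I` — the row «`rk Γ(Ker q̄ ∩ 𝒢l) = q`». [cite: Tate1997FiniteFlatGroupSchemes, (3.7)]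
[cite: Liu2021, Prop. D.8 (3) pp. 136–138] -/
theorem finrank_alg_eq_of_layer_comp_eq_one {Y : SchemeOver k} [GrpObj Y] (qbar : A.X ⟶ Y)
    (hdock : ∀ ⦃T : SchemeOver k⦄ (g : T ⟶ G₀),
      g ≫ ι₀G ≫ qbar = 1 ↔ ∃ s : T ⟶ Motives.specOver k (Alg G₀ ⧸ I), s ≫ quotIncl G₀ I = g)
    {L : SchemeOver k} (jl : L ⟶ A.X) [Mono jl] (l₀ : G₀ ⟶ L) (hl₀ : l₀ ≫ jl = ι₀G)
    (hkerdown : ∀ ⦃T : SchemeOver k⦄ (y : T ⟶ L), (y ≫ jl) ≫ qbar = 1 → ∀ r ∈ 𝔴, (y ≫ jl) ≫ act.i r = 1)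
    {K : SchemeOver k} (κ : K ⟶ L) [Mono κ]
    (hκ : ∀ ⦃T : SchemeOver k⦄ (y : T ⟶ L), (∃ c : T ⟶ K, c ≫ κ = y) ↔ (y ≫ jl) ≫ qbar = 1) :
    Module.finrank k (Alg K) = Module.finrank k (Alg G₀ ⧸ I) := by
  refine finrank_alg_eq_of_dockClause_layer G₀ ι₀G I (fun _ x => x ≫ qbar = 1) (fun _ g => ?_) jl l₀ hl₀
    (fun _ y hy => (hkerG₀ (y ≫ jl)).1 (hkerdown y hy)) κ hκ
  rw [Category.assoc]
  exact hdock g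

include hkerG₀ in
omit [Mono ι₀G] in
/-- **THE (E) SHAPE ON A LAYER FROM THE TWO DOCK CLAUSES**: `q̄ : A → Y` and a second predicate `Q` (in the application «killed by `F_q`») with the
SAME dock clause at `I` (`hdock`, `hQ` — the (R3) kernel reading and the dock Frobenius law), a layer `jl : L → A` on which both «killed by `q̄`» and
`Q` force `𝔴`-torsion (`hkerdown`, `hQdown` — the downstairs kernel bound and the Frobenius saturation of the block), and subobjects `κ`, `φ` of `L`
reading them: then «`(∃ c, c ≫ φ = y) ↔ ∃ c, c ≫ κ = y`» for every `L`-point `y` — the `hE` binder of ★ W-DOCK `WBlockLaw.law_w_of_points`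
(`Ker q̄ ∩ 𝒢l = Ker F_q ∩ 𝒢l`). [cite: Liu2021, Prop. D.8 (3) pp. 136–138] [cite: GortzWedhorn2020, Definition 4.45 (2) (p. 117)] -/
theorem points_iff_points_of_layer {Y : SchemeOver k} [GrpObj Y] (qbar : A.X ⟶ Y)
    (hdock : ∀ ⦃T : SchemeOver k⦄ (g : T ⟶ G₀),
      g ≫ ι₀G ≫ qbar = 1 ↔ ∃ s : T ⟶ Motives.specOver k (Alg G₀ ⧸ I), s ≫ quotIncl G₀ I = g)
    (Q : ∀ ⦃T : SchemeOver k⦄, (T ⟶ A.X) → Prop)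
    (hQ : ∀ ⦃T : SchemeOver k⦄ (g : T ⟶ G₀), Q (g ≫ ι₀G) ↔ ∃ s : T ⟶ Motives.specOver k (Alg G₀ ⧸ I), s ≫ quotIncl G₀ I = g)
    {L : SchemeOver k} (jl : L ⟶ A.X)
    (hkerdown : ∀ ⦃T : SchemeOver k⦄ (y : T ⟶ L), (y ≫ jl) ≫ qbar = 1 → ∀ r ∈ 𝔴, (y ≫ jl) ≫ act.i r = 1)
    (hQdown : ∀ ⦃T : SchemeOver k⦄ (y : T ⟶ L), Q (y ≫ jl) → ∀ r ∈ 𝔴, (y ≫ jl) ≫ act.i r = 1)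
    {K : SchemeOver k} (κ : K ⟶ L) (hκ : ∀ ⦃T : SchemeOver k⦄ (y : T ⟶ L), (∃ c : T ⟶ K, c ≫ κ = y) ↔ (y ≫ jl) ≫ qbar = 1)
    {Φ : SchemeOver k} (φ : Φ ⟶ L) (hφ : ∀ ⦃T : SchemeOver k⦄ (y : T ⟶ L), (∃ c : T ⟶ Φ, c ≫ φ = y) ↔ Q (y ≫ jl))
    ⦃T : SchemeOver k⦄ (y : T ⟶ L) : (∃ c : T ⟶ Φ, c ≫ φ = y) ↔ ∃ c : T ⟶ K, c ≫ κ = y := by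
  refine points_iff_points_of_dockClauses G₀ ι₀G I (fun _ x => x ≫ qbar = 1) Q (fun _ g => ?_) hQ jl
    (fun _ y hy => (hkerG₀ (y ≫ jl)).1 (hkerdown y hy)) (fun _ y hy => (hkerG₀ (y ≫ jl)).1 (hQdown y hy)) κ hκ φ hφ y
  rw [Category.assoc]
  exact hdock g

include hkerG₀ in
omit [Mono ι₀G] in
/-- **(ED. 2) THE (E) SHAPE FOR TWO COMPOSITION READINGS** — `points_iff_points_of_layer` at `Q x := x ≫ F' = 1` for a second morphism `F' : A → W` into any group object
(in the application the relative Frobenius `F_q : A_x̄ → A_x̄^{(q)}`), with BOTH dock clauses in the right-associated binder shape «`g ≫ ι₀G ≫ F' = 1 ↔ …`» of the Lines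
letters (`hdock`, `hF`), so that the Lines glue is one `exact` with no re-association inside the (large) Frobenius terms: on a layer `jl : L → A` where `q̄`-killed and
`F'`-killed points are `𝔴`-torsion (`hkerdown`, `hFdown`), subobjects `κ`, `φ` of `L` reading «`(y ≫ jl) ≫ q̄ = 1`» resp. «`(y ≫ jl) ≫ F' = 1`» have the same `T`-points.
[cite: Liu2021, Prop. D.8 (3) pp. 136–138] [cite: GortzWedhorn2020, Definition 4.45 (2) (p. 117)] -/
theorem points_iff_points_of_layer_comp_eq_one {Y : SchemeOver k} [GrpObj Y] (qbar : A.X ⟶ Y)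
    (hdock : ∀ ⦃T : SchemeOver k⦄ (g : T ⟶ G₀),
      g ≫ ι₀G ≫ qbar = 1 ↔ ∃ s : T ⟶ Motives.specOver k (Alg G₀ ⧸ I), s ≫ quotIncl G₀ I = g)
    {W : SchemeOver k} [GrpObj W] (F' : A.X ⟶ W)
    (hF : ∀ ⦃T : SchemeOver k⦄ (g : T ⟶ G₀),
      g ≫ ι₀G ≫ F' = 1 ↔ ∃ s : T ⟶ Motives.specOver k (Alg G₀ ⧸ I), s ≫ quotIncl G₀ I = g)
    {L : SchemeOver k} (jl : L ⟶ A.X)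
    (hkerdown : ∀ ⦃T : SchemeOver k⦄ (y : T ⟶ L), (y ≫ jl) ≫ qbar = 1 → ∀ r ∈ 𝔴, (y ≫ jl) ≫ act.i r = 1)
    (hFdown : ∀ ⦃T : SchemeOver k⦄ (y : T ⟶ L), (y ≫ jl) ≫ F' = 1 → ∀ r ∈ 𝔴, (y ≫ jl) ≫ act.i r = 1)
    {K : SchemeOver k} (κ : K ⟶ L) (hκ : ∀ ⦃T : SchemeOver k⦄ (y : T ⟶ L), (∃ c : T ⟶ K, c ≫ κ = y) ↔ (y ≫ jl) ≫ qbar = 1)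
    {Φ : SchemeOver k} (φ : Φ ⟶ L) (hφ : ∀ ⦃T : SchemeOver k⦄ (y : T ⟶ L), (∃ c : T ⟶ Φ, c ≫ φ = y) ↔ (y ≫ jl) ≫ F' = 1)
    ⦃T : SchemeOver k⦄ (y : T ⟶ L) : (∃ c : T ⟶ Φ, c ≫ φ = y) ↔ ∃ c : T ⟶ K, c ≫ κ = y := by
  refine points_iff_points_of_layer A act 𝔴 G₀ ι₀G hkerG₀ I qbar hdock (fun _ x => x ≫ F' = 1) (fun _ g => ?_) jl hkerdown hFdown κ hκ φ hφ y
  rw [Category.assoc]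
  exact hF g

end Abelian

end Literature.AlgebraicGeometry.AbelianSchemes.DockKernelReading

end
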